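import Literature.NumberTheory.LFunctions.WeilFactorizationPointCountEstimate
import Literature.AlgebraicGeometry.Motives.FrobeniusTraceProofs
import HarnessLib

/-!
# A Weil factorisation is determined by its point-count formula: `#X(𝔽_{q^m}) = Σᵢ (−1)ⁱ Σⱼ α_{ij}^m`
# for all `m ≥ 1` FORCES `Z(X, T) · ∏_{i even} Pᵢ(T) = ∏_{i odd} Pᵢ(T)` (injectivity of the ghost map)

Topic `Literature/NumberTheory/LFunctions`; THEOREMS ONLY (no definition, no instance, no named fact;
D-0026).  The CONVERSE of the tree's `pointCount_eq_sum_sum_roots`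
(`WeilFactorizationPointCountEstimate` §2: a Weil factorisation `(Pᵢ)` of `Z(X, T)` gives
`#X(𝔽_{q^m}) = Σᵢ (−1)ⁱ Σⱼ α_{ij}^m`): polynomials `Pᵢ ∈ ℤ[T]` with `Pᵢ(0) = 1` whose reciprocal roots
reproduce the point counts in this way automatically satisfy the rationality identity
`Z(X, T) ∏_{i even} Pᵢ = ∏_{i odd} Pᵢ` in `ℚ⟦T⟧`; with the two end polynomials and the Riemann hypothesis
they form a Weil factorisation.  This is the tool by which Weil factorisations are TRANSPORTED along
identities of point counts (products `#(X × Y) = #X · #Y`, fibrations, constant field extensions, …)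
without any cohomology theory.

## Sources, verbatim

N. Ramachandran, *Zeta functions, Grothendieck groups, and the Witt ring*, Bull. Sci. Math. 139 (2015)
[Ramachandran2014], §1: «Recall the identities … `−log(1 − bt) = Σ_{r ≥ 1} bʳ tʳ/r`,
`t d/dt log (1/(1 − bt)) = bt/(1 − bt) = bt + b²t² + ⋯`», «The (functorial) ghost map `gh : W(A) → A^ℕ` …
`t (1/P) dP/dt = Σ_{r>0} gh_r(P) tʳ`.  It is clear that the ghost map is injective»; Lemma 2.3: «The ghost
components of `P(t) = exp(Σ_{r ≥ 1} b_r tʳ/r) ∈ W(ℤ)` are given by `gh(P) = (b_1, b_2, b_3, ⋯)`»; proof of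
Theorem 2.1 (i): «Applying Lemma 2.3 to `Z(X,t) = exp(Σ_{r ≥ 1} #X(𝔽_{q^r}) tʳ/r)`, we find that `#X(𝔽_{qⁿ})` is
the `n`'th ghost component of `Z(X,t)`», second proof: «We can write `Z(X,t)` in `W(ℚ̄_ℓ)` as a sum `Σ [α_X]`
over the (inverse) eigenvalues `α_X` of Frobenius».
P. Deligne, *La conjecture de Weil. I* [Deligne1974], (1.5.2)–(1.5.4): `t d/dt log Z = Σ_n #X(𝔽_{qⁿ}) tⁿ`,
`t d/dt log det(1 − F t)⁻¹ = Σ Tr(Fⁿ) tⁿ`, `Z(X, t) = ∏ᵢ Pᵢ(X, t)^{(−1)^{i+1}}`.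
B. Poonen, *Rational points on varieties* [Poonen2017], Th. 7.1.1 (ii) p. 205 (the point-count formula).

## What is here

* §1 (a field `F` of characteristic `0`) the scalar case of Deligne's (1.5.3):
  **`exp_subst_powSeries_mul_one_sub`**: `exp(Σ_{m ≥ 1} cᵐ Tᵐ/m) · (1 − cT) = 1` in `F⟦T⟧`
  («`−log(1 − bt) = Σ bʳtʳ/r`»), whence **`coe_eq_exp_subst_neg_of_splits`**: a split polynomial `A` with
  `A(0) = 1` is `A = ∏_z (1 − z⁻¹T) = exp(−Σ_z Σ_{m ≥ 1} z^{−m} Tᵐ/m)` over its roots `z` with multiplicity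
  («`Z = Σ [α]` in `W`»).
* §2 (a scheme `V` over a finite field `k`, `q = #k`, polynomials `Pᵢ ∈ ℤ[T]`, `i ≤ 2n`, with `Pᵢ(0) = 1`)
  **`zetaSeries_mul_prod_eq_prod_of_pointCount_eq`**: if
  `#V(𝔽_{q^m}) = Σᵢ (−1)ⁱ Σ_{z : Pᵢ(z) = 0} z^{−m}` in `ℂ` for all `m ≥ 1`, then
  `Z(V, T) · ∏_{i even} Pᵢ = ∏_{i odd} Pᵢ` in `ℚ⟦T⟧` (the ghost components `#V(𝔽_{q^m})` of `Z(V,T)` determine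
  it: Lemma 2.3 and «the ghost map is injective»);
  **`isWeilFactorization_of_pointCount_eq`**: adding `P₀ = 1 − T`, `P₂ₙ = 1 − qⁿT` and the Riemann
  hypothesis `|z| = q^{−i/2}` gives `IsWeilFactorization q n (zetaSeries V) P`;
  **`isWeilFactorization_iff_pointCount_eq`**: a Weil factorisation of `Z(V, T)` is EXACTLY a family
  `(Pᵢ)` with `Pᵢ(0) = 1`, the two ends, the Riemann hypothesis and the point-count formula for all `m ≥ 1`
  (with the tree's `pointCount_eq_sum_sum_roots` for the forward direction).

HC is not touched.

## References

* [Ramachandran2014] N. Ramachandran, *Zeta functions, Grothendieck groups, and the Witt ring*, Bull. Sci.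
  Math. 139 (2015) 599–627 (arXiv:1407.1813), §1 (ghost map), Lemma 2.3, Theorem 2.1 (i) and its proofs.
* [Deligne1974] P. Deligne, *La conjecture de Weil. I*, Publ. Math. IHÉS 43 (1974), (1.5.2)–(1.5.4).
* [Poonen2017] B. Poonen, *Rational points on varieties*, GSM 186 (2017), Th. 7.1.1 (ii).
* Tree: `Motives/FrobeniusTraceProofs` (`FrobeniusTrace.exp_subst_add`, `…exp_subst_sum`,
  `…exp_subst_mul_exp_subst_neg`, `…constantCoeff_exp_subst`, `…derivative_exp_subst`),
  `LFunctions/WeilFactorizationPointCountEstimate` (`pointCount_eq_sum_sum_roots`).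

## Provenance

Lane `lit-hodgefound` (summit `HodgeConjecture`, Track 2 foundations library, Layer B: motives / zeta functions —
the zeta function of a product `Z(X × Y) = Z(X) ∗ Z(Y)`), seat `lit-hodgefound-p29` (literature-prover,
generation 45, row g45-#2).
-/

universe u

open Polynomial
open scoped PowerSeries

noncomputable section

namespace Literature.NumberTheory.LFunctions

/-! ### §1 `1 − cT = exp(−Σ_{m ≥ 1} cᵐ Tᵐ/m)` and `P = exp(−Σ_z Σ_m z^{−m} Tᵐ/m)` for `P(0) = 1` -/

section Scalar

open PowerSeries
open Literature.AlgebraicGeometry.Motives.FrobeniusTrace (constantCoeff_exp_subst derivative_exp_subst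
  exp_subst_mul_exp_subst_neg exp_subst_add exp_subst_zero)

variable {F : Type*} [Field F] [CharZero F]

/-- `Σ_{m ≥ 1} cᵐ Tᵐ/m` (written `PowerSeries.mk fun m => (m : ℚ)⁻¹ • c ^ m`, coefficient of `T⁰` is
`(0 : ℚ)⁻¹ • 1 = 0`) has no constant term. [folklore] -/
private theorem constantCoeff_powSeries (c : F) :
    constantCoeff (PowerSeries.mk fun m => (m : ℚ)⁻¹ • c ^ m : F⟦X⟧) = 0 := by
  rw [← coeff_zero_eq_constantCoeff_apply, coeff_mk, Nat.cast_zero, inv_zero, zero_smul]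

/-- `(Σ_{m ≥ 1} cᵐ Tᵐ/m)′ = Σ_{m ≥ 0} c^{m+1} Tᵐ`. [folklore] -/
private theorem derivative_powSeries (c : F) :
    d⁄dX F (PowerSeries.mk fun m => (m : ℚ)⁻¹ • c ^ m) = PowerSeries.mk fun m => c ^ (m + 1) := by
  ext m
  rw [PowerSeries.coeff_derivative, coeff_mk, coeff_mk, ← Nat.cast_succ, ← nsmul_eq_mul',
    ← Nat.cast_smul_eq_nsmul ℚ, smul_smul, mul_inv_cancel₀ (Nat.cast_ne_zero.mpr (Nat.succ_ne_zero m)), one_smul]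

omit [CharZero F] in
/-- `(1 − cT) · Σ_{m ≥ 0} c^{m+1} Tᵐ = c`. [folklore] -/
private theorem one_sub_mul_mk_pow_succ (c : F) :
    ((1 : F⟦X⟧) - PowerSeries.C c * PowerSeries.X) * (PowerSeries.mk fun m => c ^ (m + 1)) = PowerSeries.C c := by
  ext m
  rw [sub_mul, one_mul, map_sub, mul_assoc, PowerSeries.coeff_C_mul, PowerSeries.coeff_C]
  cases m with
  | zero => rw [coeff_mk, coeff_zero_X_mul, mul_zero, sub_zero, if_pos rfl, zero_add, pow_one]
  | succ m => rw [coeff_mk, coeff_succ_X_mul, coeff_mk, if_neg (Nat.succ_ne_zero m), pow_succ, mul_comm c, sub_self]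

omit [CharZero F] in
/-- The polynomial `1 − cT` as a power series. [folklore] -/
private theorem coe_one_sub_C_mul_X (c : F) :
    (((1 : F[X]) - Polynomial.C c * Polynomial.X : F[X]) : F⟦X⟧) = 1 - PowerSeries.C c * PowerSeries.X := by
  rw [Polynomial.coe_sub, Polynomial.coe_one, Polynomial.coe_mul, Polynomial.coe_C, Polynomial.coe_X]

/-- **Deligne (1.5.3) in rank one / «`−log(1 − bt) = Σ_{r ≥ 1} bʳ tʳ/r`»**: for `c` in a field `F` of
characteristic `0`, `exp(Σ_{m ≥ 1} cᵐ Tᵐ/m) · (1 − cT) = 1` in `F⟦T⟧` — both sides have zero derivative and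
constant term `1`. [cite: Ramachandran2014, §1 (identities before the ghost map)] [cite: Deligne1974, (1.5.3)] -/
theorem exp_subst_powSeries_mul_one_sub (c : F) :
    (exp F).subst (PowerSeries.mk fun m => (m : ℚ)⁻¹ • c ^ m) *
      ((((1 : F[X]) - Polynomial.C c * Polynomial.X : F[X]) : F⟦X⟧)) = 1 := by
  haveI := IsAddTorsionFree.of_module_rat (M := F)
  rw [coe_one_sub_C_mul_X]
  have hd1 : d⁄dX F ((1 : F⟦X⟧) - PowerSeries.C c * PowerSeries.X) = -PowerSeries.C c := by
    rw [map_sub, Derivation.map_one_eq_zero, Derivation.leibniz, PowerSeries.derivative_X,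
      PowerSeries.derivative_C, smul_zero, add_zero, smul_eq_mul, mul_one, zero_sub]
  have hde : d⁄dX F ((exp F).subst (PowerSeries.mk fun m => (m : ℚ)⁻¹ • c ^ m)) =
      (exp F).subst (PowerSeries.mk fun m => (m : ℚ)⁻¹ • c ^ m) * PowerSeries.mk fun m => c ^ (m + 1) := by
    rw [derivative_exp_subst (constantCoeff_powSeries c), derivative_powSeries]
  have key := one_sub_mul_mk_pow_succ c
  refine derivative.ext ?_ ?_
  · rw [Derivation.leibniz, smul_eq_mul, smul_eq_mul, hd1, hde, Derivation.map_one_eq_zero]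
    linear_combination ((exp F).subst (PowerSeries.mk fun m => (m : ℚ)⁻¹ • c ^ m)) * key
  · rw [map_mul, constantCoeff_exp_subst (constantCoeff_powSeries c), one_mul, map_one, map_sub, map_one,
      map_mul, constantCoeff_C, constantCoeff_X, mul_zero, sub_zero]

/-- Hence `1 − cT = exp(−Σ_{m ≥ 1} cᵐ Tᵐ/m)` in `F⟦T⟧`. [cite: Ramachandran2014, §1] [cite: Deligne1974, (1.5.3)] -/
theorem coe_one_sub_C_mul_X_eq_exp_subst_neg (c : F) :
    ((((1 : F[X]) - Polynomial.C c * Polynomial.X : F[X]) : F⟦X⟧)) =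
      (exp F).subst (-PowerSeries.mk fun m => (m : ℚ)⁻¹ • c ^ m) := by
  have h1 := exp_subst_powSeries_mul_one_sub c
  have h2 := exp_subst_mul_exp_subst_neg (constantCoeff_powSeries c)
  calc ((((1 : F[X]) - Polynomial.C c * Polynomial.X : F[X]) : F⟦X⟧))
      = (exp F).subst (PowerSeries.mk fun m => (m : ℚ)⁻¹ • c ^ m) *
          (exp F).subst (-PowerSeries.mk fun m => (m : ℚ)⁻¹ • c ^ m) *
          ((((1 : F[X]) - Polynomial.C c * Polynomial.X : F[X]) : F⟦X⟧)) := by rw [h2, one_mul]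
    _ = (exp F).subst (-PowerSeries.mk fun m => (m : ℚ)⁻¹ • c ^ m) *
          ((exp F).subst (PowerSeries.mk fun m => (m : ℚ)⁻¹ • c ^ m) *
            ((((1 : F[X]) - Polynomial.C c * Polynomial.X : F[X]) : F⟦X⟧))) := by ring
    _ = (exp F).subst (-PowerSeries.mk fun m => (m : ℚ)⁻¹ • c ^ m) := by rw [h1, mul_one]

/-- `exp` of a multiset sum of series without constant term is the product of the `exp`s. [folklore] -/
private theorem exp_subst_multiset_sum {α : Type*} (s : Multiset α) (f : α → F⟦X⟧)
    (h : ∀ a ∈ s, constantCoeff (f a) = 0) :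
    (s.map fun a => (exp F).subst (f a)).prod = (exp F).subst (s.map f).sum := by
  induction s using Multiset.induction_on with
  | empty => rw [Multiset.map_zero, Multiset.prod_zero, Multiset.map_zero, Multiset.sum_zero, exp_subst_zero]
  | cons a s ih =>
    have ha : constantCoeff (f a) = 0 := h a (Multiset.mem_cons_self a s)
    have hs : ∀ b ∈ s, constantCoeff (f b) = 0 := fun b hb => h b (Multiset.mem_cons_of_mem hb)
    have hsum : constantCoeff (s.map f).sum = 0 := by
      rw [map_multiset_sum, Multiset.map_map]
      exact Multiset.sum_eq_zero fun x hx => by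
        obtain ⟨b, hb, rfl⟩ := Multiset.mem_map.mp hx
        exact hs b hb
    rw [Multiset.map_cons, Multiset.prod_cons, Multiset.map_cons, Multiset.sum_cons, ih hs, exp_subst_add ha hsum]

omit [CharZero F] in
/-- The roots of a polynomial with constant coefficient `1` are non-zero. [folklore] -/
private theorem ne_zero_of_mem_roots' {A : F[X]} (hA0 : A.coeff 0 = 1) {z : F} (hz : z ∈ A.roots) : z ≠ 0 := by
  rintro rfl
  have hne : A ≠ 0 := fun h' => by rw [h', coeff_zero] at hA0; exact zero_ne_one hA0
  have h1 := (mem_roots hne).mp hz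
  rw [IsRoot.def, ← coeff_zero_eq_eval_zero, hA0] at h1
  exact one_ne_zero h1

omit [CharZero F] in
/-- `∏_z (1 − z⁻¹T) = A` for a split `A` with `A(0) = 1` (private form; cf. the tree's
`eq_prod_one_sub_inv_mul_X` in `FunctionFieldZetaLPolynomialProofs`). [folklore] -/
private theorem prod_one_sub_C_inv_mul_X_eq {A : F[X]} (hA0 : A.coeff 0 = 1) (hsA : A.Splits) :
    (A.roots.map fun z => (1 : F[X]) - Polynomial.C z⁻¹ * Polynomial.X).prod = A := by
  have hz0 : ∀ z ∈ A.roots, z ≠ 0 := fun z hz => ne_zero_of_mem_roots' hA0 hz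
  have hfac : (A.roots.map fun z => Polynomial.X - Polynomial.C z) =
      A.roots.map fun z => Polynomial.C (-z) * ((1 : F[X]) - Polynomial.C z⁻¹ * Polynomial.X) := by
    refine Multiset.map_congr rfl fun z hz => ?_
    rw [mul_sub, ← mul_assoc, ← C_mul, mul_one, neg_mul, mul_inv_cancel₀ (hz0 z hz), C_neg, C_neg, C_1]
    ring
  have e := hsA.eq_prod_roots
  rw [hfac, Multiset.prod_map_mul, ← mul_assoc] at e
  have hc : (Polynomial.C A.leadingCoeff * (A.roots.map fun z => Polynomial.C (-z)).prod) =
      Polynomial.C (A.leadingCoeff * (A.roots.map fun z => -z).prod) := by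
    rw [C_mul, map_multiset_prod, Multiset.map_map]
    rfl
  rw [hc] at e
  have h0' : ((A.roots.map fun z => (1 : F[X]) - Polynomial.C z⁻¹ * Polynomial.X).prod).coeff 0 = 1 := by
    rw [coeff_zero_multiset_prod, Multiset.map_map]
    have h : A.roots.map ((fun f : F[X] => f.coeff 0) ∘ fun z => (1 : F[X]) - Polynomial.C z⁻¹ * Polynomial.X) =
        A.roots.map fun _ => (1 : F) := Multiset.map_congr rfl fun z _ => by simp
    rw [h, Multiset.map_const', Multiset.prod_replicate, one_pow]
  have h1 : A.leadingCoeff * (A.roots.map fun z => -z).prod = 1 := by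
    have h := congrArg (fun f : F[X] => f.coeff 0) e
    simp only [Polynomial.coeff_C_mul, hA0, h0', mul_one] at h
    exact h.symm
  rw [h1, C_1, one_mul] at e
  exact e.symm

/-- **A split polynomial with `P(0) = 1` is `exp(−Σ_z Σ_{m ≥ 1} z^{−m} Tᵐ/m)`** over its roots `z` (with
multiplicity): `P = ∏_z (1 − z⁻¹T)` and `1 − αT = exp(−Σ αᵐTᵐ/m)` — Deligne's
`det(1 − Ft)⁻¹ = exp(Σ Tr(Fⁿ) tⁿ/n)` for a split characteristic polynomial, Ramachandran's «`Z = Σ [α]` in `W`».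
[cite: Deligne1974, (1.5.3)] [cite: Ramachandran2014, §1 and proof of Theorem 2.1 (i)] -/
theorem coe_eq_exp_subst_neg_of_splits {A : F[X]} (hA0 : A.coeff 0 = 1) (hsA : A.Splits) :
    (A : F⟦X⟧) = (exp F).subst
      (-(A.roots.map fun z => (PowerSeries.mk fun m => (m : ℚ)⁻¹ • z⁻¹ ^ m : F⟦X⟧)).sum) := by
  conv_lhs => rw [← prod_one_sub_C_inv_mul_X_eq hA0 hsA]
  rw [← Polynomial.coeToPowerSeries.ringHom_apply, map_multiset_prod, Multiset.map_map]
  have h1 : A.roots.map (Polynomial.coeToPowerSeries.ringHom ∘ fun z => (1 : F[X]) - Polynomial.C z⁻¹ * Polynomial.X) =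
      A.roots.map fun z => (exp F).subst (-(PowerSeries.mk fun m => (m : ℚ)⁻¹ • z⁻¹ ^ m : F⟦X⟧)) := by
    refine Multiset.map_congr rfl fun z _ => ?_
    rw [Function.comp_apply, Polynomial.coeToPowerSeries.ringHom_apply]
    exact coe_one_sub_C_mul_X_eq_exp_subst_neg z⁻¹
  rw [h1, exp_subst_multiset_sum _ _ fun z _ => by rw [map_neg, constantCoeff_powSeries, neg_zero],
    ← Multiset.sum_map_neg]

/-- The coefficients of `Σ_z Σ_{m ≥ 1} z^{−m} Tᵐ/m`: `(m : ℚ)⁻¹ • Σ_z z^{−m}`. [folklore] -/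
private theorem coeff_sum_roots_powSeries (s : Multiset F) (m : ℕ) :
    PowerSeries.coeff m (s.map fun z => (PowerSeries.mk fun m => (m : ℚ)⁻¹ • z⁻¹ ^ m : F⟦X⟧)).sum =
      (m : ℚ)⁻¹ • (s.map fun z => z⁻¹ ^ m).sum := by
  rw [map_multiset_sum, Multiset.map_map, Multiset.smul_sum, Multiset.map_map]
  exact congrArg _ (Multiset.map_congr rfl fun z _ => by simp only [Function.comp_apply, coeff_mk])

end Scalar

/-! ### §2 The point-count formula forces the rationality identity, hence a Weil factorisation -/

section Converse

open PowerSeries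
open Literature.AlgebraicGeometry.Motives (SchemeOver IsWeilFactorization zetaSeries logZetaSeries pointCount
  coeff_logZetaSeries hasSubst_logZetaSeries)
open Literature.AlgebraicGeometry.Motives.FrobeniusTrace (exp_subst_add exp_subst_sum)

variable {k : Type u} [Field k] [Finite k]

/-- `Σᵢ (−1)ⁱ f i = Σ_{i even} f i − Σ_{i odd} f i` over `Fin N`. [folklore] -/
private theorem sum_neg_one_pow_mul_eq' {R : Type*} [CommRing R] {N : ℕ} (f : Fin N → R) :
    ∑ i : Fin N, (-1 : R) ^ (i : ℕ) * f i =
      ∑ i ∈ (Finset.univ : Finset (Fin N)) with Even i.val, f i -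
        ∑ i ∈ (Finset.univ : Finset (Fin N)) with Odd i.val, f i := by
  rw [← Finset.sum_filter_add_sum_filter_not Finset.univ (fun i : Fin N => Even i.val), sub_eq_add_neg,
    ← Finset.sum_neg_distrib]
  congr 1
  · exact Finset.sum_congr rfl fun i hi => by rw [(Finset.mem_filter.mp hi).2.neg_one_pow, one_mul]
  · refine Finset.sum_congr (by ext i; simp [Nat.not_even_iff_odd]) fun i hi => ?_
    rw [Finset.mem_filter] at hi
    rw [hi.2.neg_one_pow, neg_one_mul]

/-- The base change `ℚ⟦T⟧ → ℂ⟦T⟧` of an integral polynomial. [folklore] -/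
private theorem map_coe_intPoly (P : ℤ[X]) :
    PowerSeries.map (algebraMap ℚ ℂ) ((P.map (Int.castRingHom ℚ) : ℚ[X]) : ℚ⟦X⟧) =
      ((P.map (Int.castRingHom ℂ) : ℂ[X]) : ℂ⟦X⟧) := by
  ext j
  simp [Polynomial.coeff_coe]

/-- **The point counts determine the zeta function: `#V(𝔽_{q^m}) = Σᵢ (−1)ⁱ Σⱼ α_{ij}^m` for all `m ≥ 1`
forces `Z(V, T) · ∏_{i even} Pᵢ(T) = ∏_{i odd} Pᵢ(T)`** in `ℚ⟦T⟧`.  Here `V` is any scheme over the finite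
field `k`, `Pᵢ ∈ ℤ[T]` (`i ≤ 2n`) have `Pᵢ(0) = 1`, and the inner sums run over the complex roots `z = α⁻¹` of `Pᵢ`
with multiplicity.  Proof: `Z(V,T) = exp(Σ_m #V(𝔽_{q^m}) Tᵐ/m)` (the `#V(𝔽_{q^m})` are its ghost components,
Lemma 2.3) and `Pᵢ = exp(−Σⱼ Σ_m α_{ij}^m Tᵐ/m)`, so the hypothesis says `log Z = Σ_{even} Lᵢ − Σ_{odd} Lᵢ` —
«the ghost map is injective». [cite: Ramachandran2014, Lemma 2.3 and proof of Theorem 2.1 (i)] [cite: Deligne1974, (1.5.2)–(1.5.4)] -/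
theorem zetaSeries_mul_prod_eq_prod_of_pointCount_eq {n : ℕ} {V : SchemeOver k}
    {P : Fin (2 * n + 1) → ℤ[X]} (h0 : ∀ i, (P i).coeff 0 = 1)
    (hN : ∀ m : ℕ, (pointCount V (m + 1) : ℂ) =
      ∑ i : Fin (2 * n + 1), (-1 : ℂ) ^ (i : ℕ) *
        (((P i).map (Int.castRingHom ℂ)).roots.map fun z => z⁻¹ ^ (m + 1)).sum) :
    zetaSeries V * (∏ i ∈ (Finset.univ : Finset (Fin (2 * n + 1))) with Even i.val,
        ((P i).map (Int.castRingHom ℚ) : PowerSeries ℚ)) =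
      ∏ i ∈ (Finset.univ : Finset (Fin (2 * n + 1))) with Odd i.val,
        ((P i).map (Int.castRingHom ℚ) : PowerSeries ℚ) := by
  set φ : ℚ →+* ℂ := algebraMap ℚ ℂ with hφ_def
  apply PowerSeries.map_injective φ φ.injective
  set A : Fin (2 * n + 1) → ℂ[X] := fun i => (P i).map (Int.castRingHom ℂ) with hA_def
  have hA0 : ∀ i, (A i).coeff 0 = 1 := fun i => by
    simp only [hA_def, Polynomial.coeff_map, h0 i, map_one]
  -- the logarithms `Lᵢ = Σⱼ Σ_m α_{ij}^m Tᵐ/m`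
  set L : Fin (2 * n + 1) → ℂ⟦X⟧ := fun i =>
    ((A i).roots.map fun z => (PowerSeries.mk fun m => (m : ℚ)⁻¹ • z⁻¹ ^ m : ℂ⟦X⟧)).sum with hL_def
  have hL0 : ∀ i, constantCoeff (L i) = 0 := fun i => by
    rw [hL_def, ← coeff_zero_eq_constantCoeff_apply]
    dsimp only
    rw [coeff_sum_roots_powSeries, Nat.cast_zero, inv_zero, zero_smul]
  have hLn : ∀ i, constantCoeff (-L i) = 0 := fun i => by rw [map_neg, hL0, neg_zero]
  have hAexp : ∀ i, PowerSeries.map φ ((P i).map (Int.castRingHom ℚ) : PowerSeries ℚ) = (exp ℂ).subst (-L i) := by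
    intro i
    rw [map_coe_intPoly]
    exact coe_eq_exp_subst_neg_of_splits (hA0 i) (IsAlgClosed.splits _)
  -- `Z = exp(log Z)` base-changed, and `log Z = Σ_{even} Lᵢ − Σ_{odd} Lᵢ`
  have hZ : PowerSeries.map φ (zetaSeries V) = (exp ℂ).subst ((logZetaSeries V).map φ) := by
    have h := PowerSeries.map_subst (hasSubst_logZetaSeries V) (h := φ) (exp ℚ)
    rw [map_exp] at h
    exact h
  have hlog : (logZetaSeries V).map φ =
      ∑ i ∈ (Finset.univ : Finset (Fin (2 * n + 1))) with Even i.val, L i -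
        ∑ i ∈ (Finset.univ : Finset (Fin (2 * n + 1))) with Odd i.val, L i := by
    ext m
    rw [PowerSeries.coeff_map, coeff_logZetaSeries, map_sub, map_sum, map_sum]
    simp only [hL_def, coeff_sum_roots_powSeries]
    cases m with
    | zero =>
      rw [if_pos rfl, map_zero, Nat.cast_zero, inv_zero]
      simp only [zero_smul, Finset.sum_const_zero, sub_zero]
    | succ s =>
      rw [if_neg (Nat.succ_ne_zero s), map_div₀, map_natCast, map_natCast, hN s, sum_neg_one_pow_mul_eq',
        ← Finset.smul_sum, ← Finset.smul_sum, ← smul_sub, Rat.smul_def, Rat.cast_inv, Rat.cast_natCast,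
        div_eq_inv_mul]
  -- `∏_{even/odd} Pᵢ = exp(−Σ Lᵢ)`
  have hprod : ∀ (p : ℕ → Prop) [DecidablePred p],
      PowerSeries.map φ (∏ i ∈ (Finset.univ : Finset (Fin (2 * n + 1))) with p i.val,
          ((P i).map (Int.castRingHom ℚ) : PowerSeries ℚ)) =
        (exp ℂ).subst (-∑ i ∈ (Finset.univ : Finset (Fin (2 * n + 1))) with p i.val, L i) := by
    intro p _
    rw [map_prod, ← Finset.sum_neg_distrib, exp_subst_sum _ _ fun i _ => hLn i]
    exact Finset.prod_congr rfl fun i _ => hAexp i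
  have hev : constantCoeff (∑ i ∈ (Finset.univ : Finset (Fin (2 * n + 1))) with Even i.val, L i -
      ∑ i ∈ (Finset.univ : Finset (Fin (2 * n + 1))) with Odd i.val, L i) = 0 := by
    rw [map_sub, map_sum, map_sum, Finset.sum_eq_zero fun i _ => hL0 i, Finset.sum_eq_zero fun i _ => hL0 i,
      sub_zero]
  have hev' : constantCoeff (-∑ i ∈ (Finset.univ : Finset (Fin (2 * n + 1))) with Even i.val, L i) = 0 := by
    rw [map_neg, map_sum, Finset.sum_eq_zero fun i _ => hL0 i, neg_zero]
  rw [map_mul, hZ, hlog, hprod, hprod, ← exp_subst_add hev hev']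
  congr 1
  ring

/-- **A Weil factorisation from the point-count formula**: polynomials `Pᵢ ∈ ℤ[T]` (`i ≤ 2n`) with
`Pᵢ(0) = 1`, `P₀ = 1 − T`, `P₂ₙ = 1 − qⁿT`, all complex roots of `Pᵢ` of absolute value `q^{−i/2}`, and
`#V(𝔽_{q^m}) = Σᵢ (−1)ⁱ Σⱼ α_{ij}^m` for all `m ≥ 1`, form a Weil factorisation of `Z(V, T)` — the rationality
identity being FORCED by the point counts (ghost components). [cite: Ramachandran2014, Lemma 2.3 and Theorem 2.1 (i) (proof)] [cite: Deligne1974, (1.5.4) and Th. (1.6)] -/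
theorem isWeilFactorization_of_pointCount_eq {n : ℕ} {V : SchemeOver k} {P : Fin (2 * n + 1) → ℤ[X]}
    (h0 : ∀ i, (P i).coeff 0 = 1) (hP0 : P 0 = 1 - Polynomial.X)
    (hPtop : P (Fin.last (2 * n)) = 1 - Polynomial.C ((Nat.card k : ℤ) ^ n) * Polynomial.X)
    (hRH : ∀ i (z : ℂ), ((P i).map (Int.castRingHom ℂ)).IsRoot z → ‖z‖ = (Nat.card k : ℝ) ^ (-((i : ℕ) : ℝ) / 2))
    (hN : ∀ m : ℕ, (pointCount V (m + 1) : ℂ) =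
      ∑ i : Fin (2 * n + 1), (-1 : ℂ) ^ (i : ℕ) *
        (((P i).map (Int.castRingHom ℂ)).roots.map fun z => z⁻¹ ^ (m + 1)).sum) :
    IsWeilFactorization (Nat.card k) n (zetaSeries V) P :=
  ⟨h0, zetaSeries_mul_prod_eq_prod_of_pointCount_eq h0 hN, hP0, hPtop, hRH⟩

/-- **A Weil factorisation of `Z(V, T)` IS a family `(Pᵢ)_{i ≤ 2n}` of integral polynomials with `Pᵢ(0) = 1`,
`P₀ = 1 − T`, `P₂ₙ = 1 − qⁿT`, the Riemann hypothesis, and the point-count formula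
`#V(𝔽_{q^m}) = Σᵢ (−1)ⁱ Σⱼ α_{ij}^m` for all `m ≥ 1`** (forward: the tree's `pointCount_eq_sum_sum_roots`,
Poonen Th. 7.1.1 (ii); backward: the ghost components determine the Witt vector).
[cite: Poonen2017, Th. 7.1.1 (ii) p. 205] [cite: Ramachandran2014, Lemma 2.3 and Theorem 2.1 (i) (proof)] -/
theorem isWeilFactorization_iff_pointCount_eq {n : ℕ} {V : SchemeOver k} {P : Fin (2 * n + 1) → ℤ[X]} :
    IsWeilFactorization (Nat.card k) n (zetaSeries V) P ↔
      (∀ i, (P i).coeff 0 = 1) ∧ P 0 = 1 - Polynomial.X ∧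
      P (Fin.last (2 * n)) = 1 - Polynomial.C ((Nat.card k : ℤ) ^ n) * Polynomial.X ∧
      (∀ i (z : ℂ), ((P i).map (Int.castRingHom ℂ)).IsRoot z → ‖z‖ = (Nat.card k : ℝ) ^ (-((i : ℕ) : ℝ) / 2)) ∧
      ∀ m : ℕ, (pointCount V (m + 1) : ℂ) =
        ∑ i : Fin (2 * n + 1), (-1 : ℂ) ^ (i : ℕ) *
          (((P i).map (Int.castRingHom ℂ)).roots.map fun z => z⁻¹ ^ (m + 1)).sum :=
  ⟨fun hW => ⟨hW.1, hW.2.2.1, hW.2.2.2.1, hW.2.2.2.2, pointCount_eq_sum_sum_roots hW⟩,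
    fun h => isWeilFactorization_of_pointCount_eq h.1 h.2.1 h.2.2.1 h.2.2.2.1 h.2.2.2.2⟩

end Converse

end Literature.NumberTheory.LFunctions
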